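import Summits.AtomisticToContinuum.HydrodynamicLimit.Theorems.InformationPercolationEnginePercolationClosesChaosDockingTarget
import Summits.AtomisticToContinuum.HydrodynamicLimit.Theorems.InformationPercolationEnginePercolationClosesChaosDockingTriples
import Literature.Analysis.FluidPDE.EmpiricalCollisionMeasureMeasurable
import HarnessLib

/-!
# Docking S7 of the line `equilibrium-forecast-chain-rule` (crux `InformationPercolationEngine.PercolationClosesChaos`,
stmt-AtomisticToContinuum-15178) — piece E: time tiling of the target's defect and the unit-average dictionary

Support file (`--supports stmt-AtomisticToContinuum-15178`) of the registered stub `stub_docking` (worker S7 of lead c2).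
On a good orbit the target's defect `dockDefect = ε_N/(N+1) · collisionPairSum (Icc 0 τ) dockSummand` (piece A) splits
along the kinetic steps `stepWindow k = (kΔ, (k+1)Δ]`, `k < K_N = ⌊τ/Δ⌋`:

* `collisionPairSum_Ioc_eq_sum_stepWindow`: `(0, KΔ]` is the disjoint union of the first `K` step windows;
* `dockDefect_eq_sum` (registered helper): `dockDefect = ε/(N+1) · [Σ_{contact pairs at time 0} + Σ_{k<K} Σ_{triples of
  step k} + Σ_{triples in the tail (KΔ, τ]}] dockSummand` — the time-`0` atom is `localGibbsLaw`-null
  (`contactPairs_flow_zero_eq_empty` off the contact set) and the tail lies inside step `K` (`card_collTriples_tail_le`);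
* `card_collTriples_stepWindow_eq`: `#triples of step k = (n̄c) Σ_q rowCount q`;
* the unit-average dictionary for partial step sums of nonnegative box-supported families
  (`pairWeight_mul_sum_range_le_unitAvg`: `ε/(N+1) · (n̄c) · Σ_{k<M} Σ_q F ≤ πσ³ τ' · unitAvg_{τ'} F` for `M ≤ K_{τ'}`) and
  the level split of the row counts (`mul_sum_rowCount_le`: `h³ Σ_q rowCount q ≤ 27 T + h³ Σ_q rowCount q 𝟙{T < rowCount q}`).

Bookkeeping on the good set (CIP 1994 §4.2: finitely many collisions in bounded windows).
-/

noncomputable section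

open MeasureTheory Set Filter Topology
open scoped ENNReal BigOperators Classical
open Literature.Analysis.FluidPDE Literature.MathematicalPhysics.KineticTheory
open Literature.MathematicalPhysics.KineticTheory.VelocityBlindPlacement

namespace Summit.AtomisticToContinuum.HydrodynamicLimit.Theorems.EquilibriumForecastLine

section Tiling

variable {σ : ℝ} {N : ℕ} (Φ : Flow σ N) {z : Phase N}

/-- Additivity of collision pair sums along the flow over disjoint bounded windows. [folklore] -/
theorem collisionPairSum_union' (hz : z ∈ Φ.good) {S T : Set ℝ} {a b : ℝ} (hS : S ⊆ Icc a b) (hT : T ⊆ Icc a b)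
    (hST : Disjoint S T) (g : ℝ → Phase N → Fin (N + 1) → Fin (N + 1) → ℝ) :
    Φ.collisionPairSum (S ∪ T) g z = Φ.collisionPairSum S g z + Φ.collisionPairSum T g z := by
  unfold HardSphereFlow.collisionPairSum
  exact Literature.Analysis.FluidPDE.collisionPairSum_union (Φ.finite_collisionTimes_inter hz hS)
    (Φ.finite_collisionTimes_inter hz hT) hST _

/-- **`(0, KΔ]` is tiled by the first `K` step windows**: the collision pair sum over `(0, KΔ]` is the sum over `k < K` of
the sums over `stepWindow k`. [folklore] -/
theorem collisionPairSum_Ioc_eq_sum_stepWindow (hz : z ∈ Φ.good) {c : ℝ} (hc : 0 < c) (hσ : 0 < σ)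
    (g : ℝ → Phase N → Fin (N + 1) → Fin (N + 1) → ℝ) (K : ℕ) :
    Φ.collisionPairSum (Ioc 0 ((K : ℝ) * stepLen c σ N)) g z =
      ∑ k ∈ Finset.range K, Φ.collisionPairSum (stepWindow c σ N k) g z := by
  have hΔ := stepLen_pos hc hσ N
  induction K with
  | zero => simp [HardSphereFlow.collisionPairSum]
  | succ K ih =>
    have hK0 : (0 : ℝ) ≤ (K : ℝ) * stepLen c σ N := by positivity
    have hK1 : (K : ℝ) * stepLen c σ N ≤ ((K : ℝ) + 1) * stepLen c σ N := by nlinarith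
    have hsplit : Ioc (0 : ℝ) (((K + 1 : ℕ) : ℝ) * stepLen c σ N) =
        Ioc 0 ((K : ℝ) * stepLen c σ N) ∪ stepWindow c σ N K := by
      rw [stepWindow, Nat.cast_succ, Ioc_union_Ioc_eq_Ioc hK0 hK1]
    rw [hsplit, collisionPairSum_union' Φ hz (Ioc_subset_Icc_self.trans (Icc_subset_Icc_right hK1))
      ((stepWindow_subset_Icc c σ N K).trans (Icc_subset_Icc_left hK0))
      (disjoint_left.2 fun t ht ht' => not_lt.2 ht.2 ht'.1) g, ih, Finset.sum_range_succ]

/-- **Registered helper `dockDefect_eq_sum` (piece E of the docking S7): the time tiling of the target's defect.** On a good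
orbit, with `K = numSteps c σ N τ` complete steps (`0 ≤ τ`),
`dockDefect = ε/(N+1) · [Σ_{contact pairs at time 0} dS + Σ_{k<K} Σ_{triples of step k} dS + Σ_{triples in (KΔ, τ]} dS]`.
[folklore] -/
theorem dockDefect_eq_sum : ∀ {σ : ℝ} {N : ℕ} (Φ : Flow σ N) {z : Phase N}, z ∈ Φ.good → ∀ (χ : ℝ × T3 → ℝ) (Ψ : V3 × V3 × V3 → ℝ) (r : ℝ) {τ c : ℝ}, 0 ≤ τ → 0 < c → 0 < σ → dockDefect χ Ψ r τ σ N Φ z = hsDiameter σ N / ((N : ℝ) + 1) * ((∑ p ∈ contactPairs G3 (hsDiameter σ N) (Φ.flow 0 z), dockSummand χ Ψ r τ σ N Φ z 0 (Φ.flow 0 z) p.1 p.2) + ∑ k ∈ Finset.range (numSteps c σ N τ), ∑ e ∈ collTriples Φ (stepWindow c σ N k) z, dockSummand χ Ψ r τ σ N Φ z e.1 (Φ.flow e.1 z) e.2.1 e.2.2 + ∑ e ∈ collTriples Φ (Ioc ((numSteps c σ N τ : ℝ) * stepLen c σ N) τ) z, dockSummand χ Ψ r τ σ N Φ z e.1 (Φ.flow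 e.1 z) e.2.1 e.2.2) := by
  intro σ N Φ z hz χ Ψ r τ c hτ hc hσ
  set K := numSteps c σ N τ with hK
  set g := dockSummand χ Ψ r τ σ N Φ z with hg
  have hΔ := stepLen_pos hc hσ N
  have hK0 : (0 : ℝ) ≤ (K : ℝ) * stepLen c σ N := by positivity
  have hKτ : (K : ℝ) * stepLen c σ N ≤ τ := numSteps_mul_stepLen_le hc hσ hτ N
  unfold dockDefect
  congr 1
  -- `[0, τ] = {0} ∪ (0, KΔ] ∪ (KΔ, τ]`
  have h0 : Φ.collisionPairSum (Icc 0 τ) g z = (∑ p ∈ contactPairs G3 (hsDiameter σ N) (Φ.flow 0 z), g 0 (Φ.flow 0 z) p.1 p.2) +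
      Φ.collisionPairSum (Ioc 0 τ) g z :=
    (Φ.isTrajectory z hz).collisionPairSum_Icc hτ _
  have h1 : Φ.collisionPairSum (Ioc 0 τ) g z = Φ.collisionPairSum (Ioc 0 ((K : ℝ) * stepLen c σ N)) g z +
      Φ.collisionPairSum (Ioc ((K : ℝ) * stepLen c σ N) τ) g z := by
    rw [← collisionPairSum_union' Φ hz (Ioc_subset_Icc_self.trans (Icc_subset_Icc_right hKτ))
      (Ioc_subset_Icc_self.trans (Icc_subset_Icc_left hK0)) (disjoint_left.2 fun t ht ht' => not_lt.2 ht.2 ht'.1) g,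
      Ioc_union_Ioc_eq_Ioc hK0 hKτ]
  rw [h0, h1, collisionPairSum_Ioc_eq_sum_stepWindow Φ hz hc hσ g K,
    collisionPairSum_eq_sum_collTriples Φ hz (Ioc_subset_Icc_self (a := (K : ℝ) * stepLen c σ N) (b := τ)), add_assoc]
  congr 2
  exact Finset.sum_congr rfl fun k _ => collisionPairSum_eq_sum_collTriples Φ hz (stepWindow_subset_Icc c σ N k) g

/-- **No contact pair at time `0` off the contact set** (good orbit: `Φ.flow 0 z = z`). [folklore] -/
theorem contactPairs_flow_zero_eq_empty (hz : z ∈ Φ.good)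
    (h0 : ¬ ∃ i j : Fin (N + 1), i ≠ j ∧ z ∈ contactSet G3 (N + 1) (hsDiameter σ N) i j) :
    contactPairs G3 (hsDiameter σ N) (Φ.flow 0 z) = ∅ := by
  rw [Φ.flow_zero z hz, ← Finset.not_nonempty_iff_eq_empty]
  rintro ⟨p, hp⟩
  exact h0 ⟨p.1, p.2, (mem_contactPairs.1 hp).1, (mem_contactPairs.1 hp).2⟩

/-- **The tail lies inside step `K`**: for `τ ≤ (K+1)Δ` the triples with times in `(KΔ, τ]` are triples of step `K`.
[folklore] -/
theorem card_collTriples_tail_le (hz : z ∈ Φ.good) {c τ : ℝ} {K : ℕ} (hτ : τ ≤ ((K : ℝ) + 1) * stepLen c σ N) :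
    (collTriples Φ (Ioc ((K : ℝ) * stepLen c σ N) τ) z).card ≤ (collTriples Φ (stepWindow c σ N K) z).card := by
  refine Finset.card_le_card fun e he => ?_
  rw [mem_collTriples Φ hz (Ioc_subset_Icc_self (a := (K : ℝ) * stepLen c σ N) (b := τ))] at he
  rw [mem_collTriples Φ hz (stepWindow_subset_Icc c σ N K)]
  exact ⟨⟨he.1.1, he.1.2.trans hτ⟩, he.2⟩

/-- **The triples of a step counted by rows**: `#(triples of step k) = (n̄c) Σ_{q ∈ box} rowCount q`. [folklore] -/
theorem card_collTriples_stepWindow_eq (hz : z ∈ Φ.good) {c : ℝ} (hc : 0 < c) (hσ : 0 < σ) (k : ℕ) :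
    ((collTriples Φ (stepWindow c σ N k) z).card : ℝ) =
      (cellCount c σ N * c) * ∑ q ∈ cellBox (c * meanFreePath σ N), rowCount c σ N Φ k q z := by
  rw [sum_rowCount_eq Φ hz hc hσ k, ← mul_assoc, mul_inv_cancel₀ (mul_pos (cellCount_pos hc hσ N) hc).ne', one_mul]

/-- **The over-colliding triples of a step counted by rows**: the triples whose first member starts in a cell with
`rowCount > T` number `(n̄c) Σ_{q ∈ box} rowCount q 𝟙{T < rowCount q}`. [folklore] -/
theorem card_filter_bad_eq (hz : z ∈ Φ.good) {c : ℝ} (hc : 0 < c) (hσ : 0 < σ) (k : ℕ) (T : ℝ) :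
    (((collTriples Φ (stepWindow c σ N k) z).filter fun e =>
        T < rowCount c σ N Φ k (startCell c σ N Φ k z e.2.1) z).card : ℝ) =
      (cellCount c σ N * c) * ∑ q ∈ cellBox (c * meanFreePath σ N),
        rowCount c σ N Φ k q z * (if T < rowCount c σ N Φ k q z then 1 else 0) := by
  have hh : 0 < c * meanFreePath σ N := mul_pos hc (meanFreePath_pos hσ N)
  have hpos : 0 < cellCount c σ N * c := mul_pos (cellCount_pos hc hσ N) hc
  -- each row count as a sum over the triples
  have hrow : ∀ q : Cell, rowCount c σ N Φ k q z * (if T < rowCount c σ N Φ k q z then 1 else 0) =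
      (cellCount c σ N * c)⁻¹ * ∑ e ∈ collTriples Φ (stepWindow c σ N k) z,
        (if startCell c σ N Φ k z e.2.1 = q then (if T < rowCount c σ N Φ k q z then (1 : ℝ) else 0) else 0) := by
    intro q
    rw [rowCount_eq_sum Φ hz, mul_assoc, Finset.sum_mul]
    congr 1
    refine Finset.sum_congr rfl fun e _ => ?_
    split_ifs <;> simp
  simp_rw [hrow]
  rw [← Finset.mul_sum, ← mul_assoc, mul_inv_cancel₀ hpos.ne', one_mul, Finset.sum_comm, Finset.card_eq_sum_ones,
    Nat.cast_sum, Finset.sum_filter]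
  refine Finset.sum_congr rfl fun e _ => ?_
  rw [Finset.sum_ite_eq (cellBox (c * meanFreePath σ N)) (startCell c σ N Φ k z e.2.1),
    if_pos (startCell_mem_cellBox hh Φ k z e.2.1)]
  push_cast
  rfl

end Tiling

/-! ## The unit-average dictionary for partial step sums, the level split of row counts, kinetic units -/

section Dictionary

variable {σ : ℝ} {N : ℕ} (Φ : Flow σ N)

/-- **Partial step sums against unit averages**: for a nonnegative box-supported family and `M ≤ K_{τ'}` steps,
`ε/(N+1) · (n̄c) · Σ_{k<M} Σ_{q ∈ box} F k q ≤ π σ³ τ' · unitAvg_{τ'} F`. [folklore] -/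
theorem pairWeight_mul_sum_range_le_unitAvg {c τ' : ℝ} {F : ℕ → Cell → ℝ} (hc : 0 < c) (hσ : 0 < σ) (hτ' : 0 ≤ τ')
    {M : ℕ} (hM : M ≤ numSteps c σ N τ') (hF : ∀ k, ∀ q ∉ cellBox (c * meanFreePath σ N), F k q = 0)
    (hF0 : ∀ k q, 0 ≤ F k q) :
    hsDiameter σ N / ((N : ℝ) + 1) * (cellCount c σ N * c) *
        ∑ k ∈ Finset.range M, ∑ q ∈ cellBox (c * meanFreePath σ N), F k q ≤
      Real.pi * σ ^ 3 * τ' * unitAvg c σ N τ' F := by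
  have hw : 0 ≤ hsDiameter σ N / ((N : ℝ) + 1) * (cellCount c σ N * c) :=
    mul_nonneg (div_nonneg (hsDiameter_pos hσ N).le (by positivity)) (mul_pos (cellCount_pos hc hσ N) hc).le
  refine le_trans (mul_le_mul_of_nonneg_left (Finset.sum_le_sum_of_subset_of_nonneg (Finset.range_mono hM)
    fun k _ _ => Finset.sum_nonneg fun q _ => hF0 k q) hw) ?_
  exact pairWeight_mul_sum_le_unitAvg hc hσ hτ' hF hF0

/-- **Level split of the row counts of a step**: `h³ Σ_{q ∈ box} rowCount q ≤ 27 T + h³ Σ_{q ∈ box} rowCount q 𝟙{T < rowCount q}`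
(`h = cℓ_N ≤ 1`, `T ≥ 0`; `h³ #box ≤ 27`). [folklore] -/
theorem mul_sum_rowCount_le {c : ℝ} (hc : 0 < c) (hσ : 0 < σ) (h1 : c * meanFreePath σ N ≤ 1) (k : ℕ) (z : Phase N)
    {T : ℝ} (hT : 0 ≤ T) :
    (c * meanFreePath σ N) ^ 3 * ∑ q ∈ cellBox (c * meanFreePath σ N), rowCount c σ N Φ k q z ≤
      27 * T + (c * meanFreePath σ N) ^ 3 * ∑ q ∈ cellBox (c * meanFreePath σ N),
        rowCount c σ N Φ k q z * (if T < rowCount c σ N Φ k q z then 1 else 0) := by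
  have hh : 0 < c * meanFreePath σ N := mul_pos hc (meanFreePath_pos hσ N)
  have hpt : ∀ q : Cell, rowCount c σ N Φ k q z ≤ T + rowCount c σ N Φ k q z * (if T < rowCount c σ N Φ k q z then 1 else 0) := by
    intro q
    have h0 := rowCount_nonneg hc.le hσ Φ k q z
    split_ifs with h
    · linarith
    · push Not at h; linarith
  have hsum := Finset.sum_le_sum fun q (_ : q ∈ cellBox (c * meanFreePath σ N)) => hpt q
  rw [Finset.sum_add_distrib, Finset.sum_const, nsmul_eq_mul] at hsum
  have hcard := card_cellBox_mul_le hh h1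
  set S := ∑ q ∈ cellBox (c * meanFreePath σ N), rowCount c σ N Φ k q z * (if T < rowCount c σ N Φ k q z then 1 else 0)
  calc (c * meanFreePath σ N) ^ 3 * ∑ q ∈ cellBox (c * meanFreePath σ N), rowCount c σ N Φ k q z
      ≤ (c * meanFreePath σ N) ^ 3 * (((cellBox (c * meanFreePath σ N)).card : ℝ) * T + S) :=
        mul_le_mul_of_nonneg_left hsum (pow_nonneg hh.le 3)
    _ = (c * meanFreePath σ N) ^ 3 * ((cellBox (c * meanFreePath σ N)).card : ℝ) * T + (c * meanFreePath σ N) ^ 3 * S := by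
        ring
    _ ≤ 27 * T + (c * meanFreePath σ N) ^ 3 * S := by gcongr

/-- **One more complete step fits in the doubled horizon**: `K_τ + 1 ≤ K_{2τ}` once `Δ ≤ τ`. [folklore] -/
theorem numSteps_succ_le_numSteps_two_mul {c τ : ℝ} (hc : 0 < c) (hσ : 0 < σ) (hτ : 0 ≤ τ)
    (hΔ : stepLen c σ N ≤ τ) : numSteps c σ N τ + 1 ≤ numSteps c σ N (2 * τ) := by
  have hΔ0 := stepLen_pos hc hσ N
  unfold numSteps
  have h1 : 1 ≤ τ / stepLen c σ N := by rwa [le_div_iff₀ hΔ0, one_mul]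
  have h2 : τ / stepLen c σ N + 1 ≤ 2 * τ / stepLen c σ N := by rw [mul_div_assoc]; linarith
  calc ⌊τ / stepLen c σ N⌋₊ + 1 = ⌊τ / stepLen c σ N + 1⌋₊ := (Nat.floor_add_one (div_nonneg hτ hΔ0.le)).symm
    _ ≤ ⌊2 * τ / stepLen c σ N⌋₊ := Nat.floor_le_floor h2

/-- **The kinetic step shrinks**: `Δ_N = cℓ_N → 0`, so eventually `Δ_N ≤ θ` for every `θ > 0` (fixed `c`). [folklore] -/
theorem eventually_stepLen_le {c : ℝ} (hσ : 0 < σ) {θ : ℝ} (hθ : 0 < θ) : ∃ N₁ : ℕ, ∀ N : ℕ, N₁ ≤ N → stepLen c σ N ≤ θ := by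
  have ht : Tendsto (fun N : ℕ => stepLen c σ N) atTop (nhds 0) := by
    have h := (tendsto_meanFreePath hσ).const_mul c
    rw [mul_zero] at h
    exact h
  have hev := (ht.eventually (Iic_mem_nhds hθ))
  obtain ⟨N₁, hN₁⟩ := eventually_atTop.1 hev
  exact ⟨N₁, fun N hN => hN₁ N hN⟩

/-- **Kinetic units: the cell count is `N`-independent**, `n̄ = (N+1)(cℓ_N)³ = c³/(π³σ⁶)` (`ℓ_N = (π(N+1)ε_N²)⁻¹`,
`(N+1)ε_N³ = σ³`). [folklore] -/
theorem cellCount_eq (c : ℝ) {σ : ℝ} (hσ : 0 < σ) (N : ℕ) : cellCount c σ N = c ^ 3 / (Real.pi ^ 3 * σ ^ 6) := by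
  have hε := hsDiameter_pos hσ N
  have h3 := succ_mul_hsDiameter_pow_three σ N
  have hN : (0 : ℝ) < (N : ℝ) + 1 := by positivity
  push_cast at h3
  unfold cellCount meanFreePath
  have hσ6 : σ ^ 6 = (((N : ℝ) + 1) * hsDiameter σ N ^ 3) ^ 2 := by rw [h3]; ring
  rw [hσ6]
  field_simp

end Dictionary

end Summit.AtomisticToContinuum.HydrodynamicLimit.Theorems.EquilibriumForecastLine

end
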